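import Literature.AlgebraicGeometry.FormalGeometry.WittGEUnitBoundSubscheme
import Literature.AlgebraicGeometry.Morphisms.CohAffineExactness
import Literature.AlgebraicGeometry.Modules.SectionsExact
import HarnessLib

/-!
# Unit bounds on sections: transfer along base-change squares (toward GW II Lemma 24.105 (II))

Helper file toward row b03 / crux `AnchorTransport.VariationalHodge` (stmt-HodgeConjecture-1076), line
padic-disc-transport, STUB P (`…_of_grothendieckExistence` rungs), continuing
`…GrothendieckExistenceUnitBoundSubscheme`: there Grothendieck's existence theorem for a proper scheme
was reduced to step (II) of Görtz–Wedhorn II Lemma 24.105 — the uniform bound on the kernels and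
cokernels of the units `𝓖_n → π_*π^*𝓖_n` for a GENERAL coherent formal tower, to be obtained from the
algebraic case (step (I), `…UnitBoundAlgebraic`) by the base change `Spec B̂ → Spec B` over affine
opens. The printed reduction moves the bound between the schemes `Z ⊇ V = Spec B ← Spec B/bⁿ⁺¹ →
Spec B̂`; this file supplies the bookkeeping that makes such moves possible on SECTIONS:

* `bound_of_square_down`, `bound_of_square_up`, `bound_span_of_bound` — algebra: the statement
  "`r` kills `ker θ` and `r·T ⊆ im θ`" moves along a commutative square of additive maps whose
  vertical maps are bijective and semilinear, and the set of such `r` is an ideal;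
* `sections_bound_of_isKilledBy`, `isKilledBy_kernel_cokernel_of_sections_bound` — for coherent
  `N → T` the sheaf statement "`𝒥` kills `ker θ` and `coker θ`" is equivalent to the sections
  statement on the members of an affine open covering (left exactness of sections, right exactness
  over affines, `IsKilledBy.of_iSup_eq_top`);
* `unit_app_bijective_of_le_opensRange` — the unit `N → g_*g^*N` of an OPEN immersion `g` is
  bijective on sections over opens inside the image of `g` (Mathlib `restrictFunctorIsoPullback`);
* `unit_app_baseChange` — **for a commutative square `i ≫ p = p₀ ≫ j` the unit of `p` at `N` on
  sections over `V`, followed by the pulled-back-sections map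
  `Γ(p⁻¹V, p^*N) → Γ(p₀⁻¹j⁻¹V, p₀^*j^*N)` (unit of `i`, then `i^*p^* ≅ (i ≫ p)^* = (p₀ ≫ j)^* ≅ p₀^*j^*`),
  is the unit of `j` on sections followed by the unit of `p₀` at `j^*N`** — with the semilinearity
  of both vertical maps and their bijectivity criteria (closed immersions at modules killed by the
  kernel ideal, `Modules/PullbackClosedImmersionUnitIso`; open immersions onto `V`, resp. `p⁻¹V`).

HONEST FRAMING: research route conditional on HC_CM; not a corollary; Q11.4-sentence-2 already
refuted in dim ≥ 3. Nothing here bears on `HC_CM`; no case of the Hodge conjecture is proved.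

References: GortzWedhorn2023 (II: Lemma 24.105 (II), p. 574–575); GortzWedhorn2020 (I: Prop. 7.24,
Rem. 7.25); StacksProject (Tags 01QY, 02KG, 088B).

Provenance: Literature home (family `hodge`, layer `Literature/AlgebraicGeometry/FormalGeometry`, namespace
`Literature.AlgebraicGeometry.FormalGeometry.WittGrothendieckExistence…`) of the Summits-side
`Theorems/AnchorTransportVariationalHodgePadicGrothendieckExistenceUnitSections` (route `PadicSemiregularLift` / `AnchorTransport`,
Grothendieck existence for vector bundles over `W(k)`), which `Literature/` may not import; theorems only, no
named fact, no definition. Lane `lit-hodgefound`, seat p20.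
-/

noncomputable section

-- `TopCat.Presheaf`/`Scheme.Modules` are not reducible (as in Mathlib's `AlgebraicGeometry/Modules`).
set_option backward.isDefEq.respectTransparency false

open CategoryTheory CategoryTheory.Limits _root_.AlgebraicGeometry TopologicalSpace Opposite
open Literature.AlgebraicGeometry.Modules Literature.AlgebraicGeometry.Morphisms
open Literature.AlgebraicGeometry.Motives

universe u

namespace Literature.AlgebraicGeometry.FormalGeometry.WittGrothendieckExistence

namespace GrothendieckExistenceProper

/-! ### Algebra: bounds along a square of semilinear bijections -/

section Algebra

variable {R R' S T S' T' : Type*} [CommRing R] [CommRing R'] [AddCommGroup S] [AddCommGroup T]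
  [AddCommGroup S'] [AddCommGroup T'] [Module R S] [Module R T] [Module R' S'] [Module R' T']
  (ρ : R →+* R') (θ : S → T) (θ' : S' → T') (α : S → S') (β : T → T')

omit [AddCommGroup S] [AddCommGroup T] in
/-- A map which is semilinear over a ring map sends `0` to `0`. [cite: GortzWedhorn2023, proof of Thm. 24.94 and Prop. 24.95 (pp. 566–567), auxiliary step] -/
theorem map_zero_of_semilinear {M M' : Type*} [AddCommGroup M] [AddCommGroup M'] [Module R M]
    [Module R' M'] (γ : M → M') (hγ : ∀ (r : R) (m : M), γ (r • m) = ρ r • γ m) : γ 0 = 0 := by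
  have h := hγ 0 0
  rwa [zero_smul, map_zero, zero_smul] at h

/-- **Bounds descend along a square** `β ∘ θ = θ' ∘ α` with `α` bijective and `β` injective, both
semilinear over `ρ`: if `ρ r` kills `ker θ'` and `ρ r · T' ⊆ im θ'`, then `r` kills `ker θ` and
`r · T ⊆ im θ`. [cite: GortzWedhorn2023, proof of Thm. 24.94 and Prop. 24.95 (pp. 566–567), auxiliary step] -/
theorem bound_of_square_down (hα : ∀ (r : R) (s : S), α (r • s) = ρ r • α s)
    (hβ : ∀ (r : R) (t : T), β (r • t) = ρ r • β t)
    (hcomm : ∀ s, β (θ s) = θ' (α s)) (hαb : Function.Bijective α) (hβi : Function.Injective β)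
    {r : R} (hk : ∀ s', θ' s' = 0 → ρ r • s' = 0) (hi : ∀ t', ∃ s', θ' s' = ρ r • t') :
    (∀ s, θ s = 0 → r • s = 0) ∧ (∀ t, ∃ s, θ s = r • t) := by
  have hα0 : α 0 = 0 := map_zero_of_semilinear ρ α hα
  have hβ0 : β 0 = 0 := map_zero_of_semilinear ρ β hβ
  refine ⟨fun s hs => ?_, fun t => ?_⟩
  · have h1 : θ' (α s) = 0 := by rw [← hcomm, hs, hβ0]
    have h2 : α (r • s) = α 0 := by rw [hα, hk _ h1, hα0]
    exact hαb.1 h2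
  · obtain ⟨s', hs'⟩ := hi (β t)
    obtain ⟨s, rfl⟩ := hαb.2 s'
    refine ⟨s, hβi ?_⟩
    rw [hcomm, hs', hβ]

/-- **Bounds ascend along a square** `β ∘ θ = θ' ∘ α` with `α` surjective and `β` bijective, both
semilinear over `ρ`: if `r` kills `ker θ` and `r · T ⊆ im θ`, then `ρ r` kills `ker θ'` and
`ρ r · T' ⊆ im θ'`. [cite: GortzWedhorn2023, proof of Thm. 24.94 and Prop. 24.95 (pp. 566–567), auxiliary step] -/
theorem bound_of_square_up (hα : ∀ (r : R) (s : S), α (r • s) = ρ r • α s)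
    (hβ : ∀ (r : R) (t : T), β (r • t) = ρ r • β t)
    (hcomm : ∀ s, β (θ s) = θ' (α s)) (hαs : Function.Surjective α) (hβb : Function.Bijective β)
    {r : R} (hk : ∀ s, θ s = 0 → r • s = 0) (hi : ∀ t, ∃ s, θ s = r • t) :
    (∀ s', θ' s' = 0 → ρ r • s' = 0) ∧ (∀ t', ∃ s', θ' s' = ρ r • t') := by
  have hα0 : α 0 = 0 := map_zero_of_semilinear ρ α hα
  have hβ0 : β 0 = 0 := map_zero_of_semilinear ρ β hβ
  refine ⟨fun s' hs' => ?_, fun t' => ?_⟩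
  · obtain ⟨s, rfl⟩ := hαs s'
    have h1 : β (θ s) = β 0 := by rw [hcomm, hs', hβ0]
    rw [← hα, hk s (hβb.1 h1), hα0]
  · obtain ⟨t, rfl⟩ := hβb.2 t'
    obtain ⟨s, hs⟩ := hi t
    exact ⟨α s, by rw [← hcomm, hs, hβ]⟩

/-- **The bounded scalars form an ideal**: for an additive `R`-linear `θ : S → T`, if every `r ∈ G`
kills `ker θ` and satisfies `r · T ⊆ im θ`, then so does every `r ∈ span G`. [cite: GortzWedhorn2023, proof of Thm. 24.94 and Prop. 24.95 (pp. 566–567), auxiliary step] -/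
theorem bound_span_of_bound (hadd : ∀ s₁ s₂, θ (s₁ + s₂) = θ s₁ + θ s₂)
    (hsmul : ∀ (r : R) s, θ (r • s) = r • θ s) {G : Set R}
    (hG : ∀ r ∈ G, (∀ s, θ s = 0 → r • s = 0) ∧ (∀ t, ∃ s, θ s = r • t))
    {r : R} (hr : r ∈ Ideal.span G) :
    (∀ s, θ s = 0 → r • s = 0) ∧ (∀ t, ∃ s, θ s = r • t) := by
  have hθ0 : θ 0 = 0 := by
    have h := hsmul 0 0
    rwa [zero_smul, zero_smul] at h
  refine Submodule.span_induction (p := fun r _ => (∀ s, θ s = 0 → r • s = 0) ∧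
    (∀ t, ∃ s, θ s = r • t)) hG ?_ ?_ ?_ hr
  · exact ⟨fun s _ => zero_smul _ _, fun t => ⟨0, by rw [hθ0, zero_smul]⟩⟩
  · intro a b _ _ ha hb
    refine ⟨fun s hs => by rw [add_smul, ha.1 s hs, hb.1 s hs, add_zero], fun t => ?_⟩
    obtain ⟨s₁, h₁⟩ := ha.2 t
    obtain ⟨s₂, h₂⟩ := hb.2 t
    exact ⟨s₁ + s₂, by rw [hadd, h₁, h₂, add_smul]⟩
  · intro a b _ hb
    refine ⟨fun s hs => by rw [smul_eq_mul, mul_smul, hb.1 s hs, smul_zero], fun t => ?_⟩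
    obtain ⟨s, hs⟩ := hb.2 t
    exact ⟨a • s, by rw [hsmul, hs, smul_eq_mul, mul_smul]⟩

end Algebra

/-! ### Sheaf ↔ sections: `𝒥` kills `ker θ` and `coker θ` -/

section SheafSections

variable {X : Scheme.{u}} [IsLocallyNoetherian X] {N T : X.Modules} (θ : N ⟶ T) (hN : Coh N)
  (hT : Coh T) (I : X.IdealSheafData)

include hN hT in
/-- **Sheaf ⇒ sections**: if `𝒥` kills `ker θ` and `coker θ` (`N`, `T` coherent), then on every
affine open `V`, every `r ∈ 𝒥(V)` kills `ker (θ_V : Γ(V, N) → Γ(V, T))` and satisfies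
`r · Γ(V, T) ⊆ im θ_V` (left exactness of sections; right exactness over the affine `V`). [cite: GortzWedhorn2023, proof of Thm. 24.94 and Prop. 24.95 (pp. 566–567), auxiliary step] -/
theorem sections_bound_of_isKilledBy (hk : IsKilledBy I (kernel θ)) (hc : IsKilledBy I (cokernel θ))
    (V : X.affineOpens) {r : Γ(X, V)} (hr : r ∈ I.ideal V) :
    (∀ s : Γ(N, V), θ.app V s = 0 → r • s = 0) ∧
      (∀ t : Γ(T, V), ∃ s : Γ(N, V), θ.app V s = r • t) := by
  refine ⟨fun s hs => ?_, fun t => ?_⟩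
  · obtain ⟨k, hk'⟩ := exists_kernel_ι_app_eq θ V s hs
    rw [← hk', ← Scheme.Modules.Hom.app_smul, hk V r hr k, map_zero]
  · have h0 : (cokernel.π θ).app V (r • t) = 0 := by
      rw [Scheme.Modules.Hom.app_smul]
      exact hc V r hr _
    exact exists_app_eq_of_app_cokernel_π_eq_zero θ hN hT V.2 (r • t) h0

include hN hT in
/-- **Sections ⇒ sheaf**: if on the members `V_k` of an affine open covering every `r ∈ 𝒥(V_k)`
kills `ker θ_{V_k}` and satisfies `r · Γ(V_k, T) ⊆ im θ_{V_k}`, then `𝒥` kills `ker θ` and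
`coker θ` (`IsKilledBy.of_iSup_eq_top`; sections of `coker θ` over the affine `V_k` are quotients
of `Γ(V_k, T)`). [cite: GortzWedhorn2023, proof of Thm. 24.94 and Prop. 24.95 (pp. 566–567), auxiliary step] -/
theorem isKilledBy_kernel_cokernel_of_sections_bound {ι : Type*} (V : ι → X.affineOpens)
    (hV : ⨆ k, (V k : X.Opens) = ⊤)
    (h : ∀ (k : ι) (r : Γ(X, V k)), r ∈ I.ideal (V k) →
      (∀ s : Γ(N, V k), θ.app (V k) s = 0 → r • s = 0) ∧
        (∀ t : Γ(T, V k), ∃ s : Γ(N, V k), θ.app (V k) s = r • t)) :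
    IsKilledBy I (kernel θ) ∧ IsKilledBy I (cokernel θ) := by
  have hK : Coh (kernel θ) := Coh.kernel θ hN hT
  have hC : Coh (cokernel θ) := Coh.cokernel θ hN hT
  refine ⟨IsKilledBy.of_iSup_eq_top I hK.loc V hV fun k r hr m => ?_,
    IsKilledBy.of_iSup_eq_top I hC.loc V hV fun k r hr q => ?_⟩
  · apply kernel_ι_app_injective θ (V k)
    rw [Scheme.Modules.Hom.app_smul, map_zero]
    exact (h k r hr).1 _ (app_kernel_ι_app θ (V k) m)
  · obtain ⟨t, rfl⟩ := app_surjective_of_epi (cokernel.π θ) hT.loc hC.loc (V k).2 q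
    obtain ⟨s, hs⟩ := (h k r hr).2 t
    rw [← Scheme.Modules.Hom.app_smul, ← hs]
    exact app_app_eq_zero (ShortComplex.mk θ (cokernel.π θ) (cokernel.condition θ)) (V k) s

end SheafSections

/-! ### Sections bookkeeping -/

section Sections

variable {X : Scheme.{u}}

/-- Restriction maps of an `𝒪_X`-module between equal opens are bijective. [cite: GortzWedhorn2023, proof of Thm. 24.94 and Prop. 24.95 (pp. 566–567), auxiliary step] -/
theorem presheaf_map_bijective_of_eq' (M : X.Modules) {A B : X.Opens} (h : A = B) (i : op A ⟶ op B) :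
    Function.Bijective (M.presheaf.map i) := by
  subst h
  rw [Subsingleton.elim i (𝟙 _), M.presheaf.map_id]
  exact Function.bijective_id

/-- Restricting a section forth and back along arrows between (equal) opens gives it back. [cite: GortzWedhorn2023, proof of Thm. 24.94 and Prop. 24.95 (pp. 566–567), auxiliary step] -/
theorem map_map_eq_self (M : X.Modules) {A B : X.Opens} (a : op A ⟶ op B) (b : op B ⟶ op A)
    (x : Γ(M, A)) : M.presheaf.map b (M.presheaf.map a x) = x := by
  rw [← CategoryTheory.comp_apply, ← M.presheaf.map_comp, map_eq_map M (a ≫ b) (𝟙 _) x,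
    M.presheaf.map_id]
  rfl

/-- The components of an isomorphism (as a morphism with `IsIso`) are bijective on sections. [cite: GortzWedhorn2023, proof of Thm. 24.94 and Prop. 24.95 (pp. 566–567), auxiliary step] -/
theorem app_bijective_of_isIso {A B : X.Modules} (φ : A ⟶ B) [IsIso φ] (W : X.Opens) :
    Function.Bijective (φ.app W) :=
  FormalVectorBundlesAlgebraize.app_bijective_of_iso (asIso φ) W

/-- **The unit of an open immersion is bijective on sections over opens inside its image**: for
`g : X' → X` an open immersion, any `𝒪_X`-module `N` and `W ⊆ g(X')`, the map
`Γ(W, N) → Γ(g⁻¹W, g^*N)` is bijective (`g^*N = N|_{X'}`, Mathlib `restrictFunctorIsoPullback`, and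
`g(g⁻¹W) = W`). [cite: GortzWedhorn2023, proof of Thm. 24.94 and Prop. 24.95 (pp. 566–567), auxiliary step] -/
theorem unit_app_bijective_of_le_opensRange {X' : Scheme.{u}} (g : X' ⟶ X) [IsOpenImmersion g]
    (N : X.Modules) {W : X.Opens} (hW : W ≤ g.opensRange) :
    Function.Bijective (((Scheme.Modules.pullbackPushforwardAdjunction g).unit.app N).app W) := by
  have heq : g ''ᵁ g ⁻¹ᵁ W = W := by
    rw [Scheme.Hom.image_preimage_eq_opensRange_inf, inf_eq_right.mpr hW]
  have h1 : (fun x => ((Scheme.Modules.pullbackPushforwardAdjunction g).unit.app N).app W x) =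
      (fun x => ((Scheme.Modules.restrictFunctorIsoPullback g).hom.app N).app (g ⁻¹ᵁ W)
        (N.presheaf.map (homOfLE (g.image_preimage_le W)).op x)) := by
    funext x
    exact (restrictFunctorIsoPullback_hom_app_map g N W x).symm
  change Function.Bijective
    (fun x => ((Scheme.Modules.pullbackPushforwardAdjunction g).unit.app N).app W x)
  rw [h1]
  exact (FormalVectorBundlesAlgebraize.app_bijective_of_iso
    ((Scheme.Modules.restrictFunctorIsoPullback g).app N) (g ⁻¹ᵁ W)).comp
    (presheaf_map_bijective_of_eq' N heq.symm _)

/-- **Naturality of the unit in the module, on sections**: for `φ : M → M'` and `q : Y → X`,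
`η_{M'}(φ(m)) = (q_*q^*φ)(η_M(m))` on sections over `V`. [cite: GortzWedhorn2023, proof of Thm. 24.94 and Prop. 24.95 (pp. 566–567), auxiliary step] -/
theorem unit_app_naturality_apply {Y : Scheme.{u}} (q : Y ⟶ X) {M M' : X.Modules} (φ : M ⟶ M')
    (V : X.Opens) (m : Γ(M, V)) :
    ((Scheme.Modules.pullbackPushforwardAdjunction q).unit.app M').app V (φ.app V m) =
      ((Scheme.Modules.pushforward q).map ((Scheme.Modules.pullback q).map φ)).app V
        (((Scheme.Modules.pullbackPushforwardAdjunction q).unit.app M).app V m) := by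
  have h := (Scheme.Modules.pullbackPushforwardAdjunction q).unit.naturality φ
  have h' := congrArg (fun ψ => (Scheme.Modules.Hom.app ψ V) m) h
  simp only [Functor.id_map, Functor.comp_map, Scheme.Modules.Hom.comp_app] at h'
  exact h'

end Sections

/-! ### The unit along a base-change square -/

section Square

variable {P S X₀ S₀ : Scheme.{u}} (p : P ⟶ S) (j : S₀ ⟶ S) (i : X₀ ⟶ P) (p₀ : X₀ ⟶ S₀)
  (w : i ≫ p = p₀ ≫ j) (N : S.Modules) (V : S.Opens)

include w in
/-- `i⁻¹p⁻¹V = p₀⁻¹j⁻¹V` for a commutative square `i ≫ p = p₀ ≫ j`. [cite: GortzWedhorn2023, proof of Thm. 24.94 and Prop. 24.95 (pp. 566–567), auxiliary step] -/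
theorem preimage_preimage_eq_of_comp_eq : i ⁻¹ᵁ (p ⁻¹ᵁ V) = p₀ ⁻¹ᵁ (j ⁻¹ᵁ V) := by
  change (i ≫ p) ⁻¹ᵁ V = (p₀ ≫ j) ⁻¹ᵁ V
  rw [w]

/-- **The unit along a base-change square, on sections.** For `i ≫ p = p₀ ≫ j`, an `𝒪_S`-module
`N` and `m ∈ Γ(V, N)`: pulling `η_p(m) ∈ Γ(p⁻¹V, p^*N)` back along `i` and moving it along
`i^*p^*N ≅ (i ≫ p)^*N = (p₀ ≫ j)^*N ≅ p₀^*j^*N` (and restricting along `i⁻¹p⁻¹V = p₀⁻¹j⁻¹V`) gives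
`η_{p₀}(η_j(m))`. [cite: GortzWedhorn2023, proof of Thm. 24.94 and Prop. 24.95 (pp. 566–567), auxiliary step] -/
theorem unit_app_baseChange (m : Γ(N, V)) :
    ((Scheme.Modules.pullback p₀).obj ((Scheme.Modules.pullback j).obj N)).presheaf.map
        (homOfLE (preimage_preimage_eq_of_comp_eq p j i p₀ w V).ge).op
      ((((Scheme.Modules.pullbackPushforwardAdjunction i).unit.app
          ((Scheme.Modules.pullback p).obj N)) ≫
        (Scheme.Modules.pushforward i).map
          ((Scheme.Modules.pullbackComp i p).hom.app N ≫ (Scheme.Modules.pullbackCongr w).hom.app N ≫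
            (Scheme.Modules.pullbackComp p₀ j).inv.app N)).app (p ⁻¹ᵁ V)
        ((((Scheme.Modules.pullbackPushforwardAdjunction p).unit.app N).app V m :
          Γ((Scheme.Modules.pullback p).obj N, p ⁻¹ᵁ V)))) =
      ((((Scheme.Modules.pullbackPushforwardAdjunction p₀).unit.app
          ((Scheme.Modules.pullback j).obj N)).app (j ⁻¹ᵁ V)
        ((((Scheme.Modules.pullbackPushforwardAdjunction j).unit.app N).app V m :
          Γ((Scheme.Modules.pullback j).obj N, j ⁻¹ᵁ V))) :
        Γ((Scheme.Modules.pullback p₀).obj ((Scheme.Modules.pullback j).obj N), p₀ ⁻¹ᵁ (j ⁻¹ᵁ V)))) := by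
  -- everything is a statement about `unitSection`s
  change ((Scheme.Modules.pullback p₀).obj ((Scheme.Modules.pullback j).obj N)).presheaf.map _
      (((Scheme.Modules.pullbackComp p₀ j).inv.app N).app (i ⁻¹ᵁ (p ⁻¹ᵁ V))
        (((Scheme.Modules.pullbackCongr w).hom.app N).app (i ⁻¹ᵁ (p ⁻¹ᵁ V))
          (((Scheme.Modules.pullbackComp i p).hom.app N).app (i ⁻¹ᵁ (p ⁻¹ᵁ V))
            (unitSection i ((Scheme.Modules.pullback p).obj N) (p ⁻¹ᵁ V) (unitSection p N V m))))) =
    unitSection p₀ ((Scheme.Modules.pullback j).obj N) (j ⁻¹ᵁ V) (unitSection j N V m)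
  have e2 : ((Scheme.Modules.pullbackCongr w).hom.app N).app (i ⁻¹ᵁ (p ⁻¹ᵁ V))
      (unitSection (i ≫ p) N V m) = ((Scheme.Modules.pullback (p₀ ≫ j)).obj N).presheaf.map
        (eqToHom (show (i ≫ p) ⁻¹ᵁ V = (p₀ ≫ j) ⁻¹ᵁ V by rw [w])).op (unitSection (p₀ ≫ j) N V m) :=
    pullbackCongr_hom_app_unitSection N w V m
  have e3 : ((Scheme.Modules.pullback (p₀ ≫ j)).obj N).presheaf.map
      (homOfLE (preimage_preimage_eq_of_comp_eq p j i p₀ w V).ge).op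
      (((Scheme.Modules.pullback (p₀ ≫ j)).obj N).presheaf.map
        (eqToHom (by rw [w] : (i ≫ p) ⁻¹ᵁ V = (p₀ ≫ j) ⁻¹ᵁ V)).op (unitSection (p₀ ≫ j) N V m)) =
      unitSection (p₀ ≫ j) N V m :=
    map_map_eq_self _ _ _ _
  have e4 : ((Scheme.Modules.pullback p₀).obj ((Scheme.Modules.pullback j).obj N)).presheaf.map
      (homOfLE (preimage_preimage_eq_of_comp_eq p j i p₀ w V).ge).op
      (((Scheme.Modules.pullbackComp p₀ j).inv.app N).app (i ⁻¹ᵁ (p ⁻¹ᵁ V))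
        (((Scheme.Modules.pullback (p₀ ≫ j)).obj N).presheaf.map
          (eqToHom (show (i ≫ p) ⁻¹ᵁ V = (p₀ ≫ j) ⁻¹ᵁ V by rw [w])).op
          (unitSection (p₀ ≫ j) N V m))) =
      ((Scheme.Modules.pullbackComp p₀ j).inv.app N).app (p₀ ⁻¹ᵁ (j ⁻¹ᵁ V))
        (((Scheme.Modules.pullback (p₀ ≫ j)).obj N).presheaf.map
          (homOfLE (preimage_preimage_eq_of_comp_eq p j i p₀ w V).ge).op
          (((Scheme.Modules.pullback (p₀ ≫ j)).obj N).presheaf.map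
            (eqToHom (show (i ≫ p) ⁻¹ᵁ V = (p₀ ≫ j) ⁻¹ᵁ V by rw [w])).op
            (unitSection (p₀ ≫ j) N V m))) :=
    (Scheme.Modules.Hom.app_map_apply ((Scheme.Modules.pullbackComp p₀ j).inv.app N)
      (homOfLE (preimage_preimage_eq_of_comp_eq p j i p₀ w V).ge) _).symm
  rw [pullbackComp_hom_app_unitSection p N i V m, e2, e4, e3]
  exact pullbackComp_inv_app_unitSection j N p₀ V m

/-- **Semilinearity of the pulled-back-sections map** of `unit_app_baseChange`: it carries the
action of `p♯(r)`, `r ∈ Γ(V, 𝒪_S)`, to the action of `p₀♯(j♯(r))`. [cite: GortzWedhorn2023, proof of Thm. 24.94 and Prop. 24.95 (pp. 566–567), auxiliary step] -/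
theorem baseChange_app_smul (r : Γ(S, V)) (t : Γ((Scheme.Modules.pullback p).obj N, p ⁻¹ᵁ V)) :
    ((Scheme.Modules.pullback p₀).obj ((Scheme.Modules.pullback j).obj N)).presheaf.map
        (homOfLE (preimage_preimage_eq_of_comp_eq p j i p₀ w V).ge).op
      ((((Scheme.Modules.pullbackPushforwardAdjunction i).unit.app
          ((Scheme.Modules.pullback p).obj N)) ≫
        (Scheme.Modules.pushforward i).map
          ((Scheme.Modules.pullbackComp i p).hom.app N ≫ (Scheme.Modules.pullbackCongr w).hom.app N ≫
            (Scheme.Modules.pullbackComp p₀ j).inv.app N)).app (p ⁻¹ᵁ V) (p.app V r • t)) =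
      p₀.app (j ⁻¹ᵁ V) (j.app V r) •
      ((Scheme.Modules.pullback p₀).obj ((Scheme.Modules.pullback j).obj N)).presheaf.map
        (homOfLE (preimage_preimage_eq_of_comp_eq p j i p₀ w V).ge).op
      ((((Scheme.Modules.pullbackPushforwardAdjunction i).unit.app
          ((Scheme.Modules.pullback p).obj N)) ≫
        (Scheme.Modules.pushforward i).map
          ((Scheme.Modules.pullbackComp i p).hom.app N ≫ (Scheme.Modules.pullbackCongr w).hom.app N ≫
            (Scheme.Modules.pullbackComp p₀ j).inv.app N)).app (p ⁻¹ᵁ V) t) := by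
  rw [Scheme.Modules.Hom.app_smul]
  -- the `Γ(p⁻¹V, 𝒪_P)`-action on `Γ(p⁻¹V, i_* Q) = Γ(i⁻¹p⁻¹V, Q)` is through `i♯`
  rw [pushforward_smul, Scheme.Modules.map_smul]
  congr 1
  -- `i♯(p♯(r))|_{p₀⁻¹j⁻¹V} = p₀♯(j♯(r))`
  have key : ∀ (q : X₀ ⟶ S) (hq : q = p₀ ≫ j) (e : p₀ ⁻¹ᵁ (j ⁻¹ᵁ V) ≤ q ⁻¹ᵁ V),
      q.appLE V (p₀ ⁻¹ᵁ (j ⁻¹ᵁ V)) e r = p₀.app (j ⁻¹ᵁ V) (j.app V r) := by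
    intro q hq e
    subst hq
    rw [Scheme.Hom.comp_appLE, ← Scheme.Hom.app_eq_appLE]
    rfl
  have h1 : X₀.presheaf.map (homOfLE (preimage_preimage_eq_of_comp_eq p j i p₀ w V).ge).op
      (i.app (p ⁻¹ᵁ V) (p.app V r)) =
      (i ≫ p).appLE V (p₀ ⁻¹ᵁ (j ⁻¹ᵁ V))
        (by rw [w]; exact le_rfl) r := rfl
  rw [h1]
  exact key (i ≫ p) w _

/-- **Bijectivity of the pulled-back-sections map** of `unit_app_baseChange`: it is bijective as
soon as the unit of `i` at `p^*N` is bijective on sections over `p⁻¹V` (the other constituents are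
components of isomorphisms and a restriction between equal opens). [cite: GortzWedhorn2023, proof of Thm. 24.94 and Prop. 24.95 (pp. 566–567), auxiliary step] -/
theorem baseChange_app_bijective
    (h : Function.Bijective (((Scheme.Modules.pullbackPushforwardAdjunction i).unit.app
      ((Scheme.Modules.pullback p).obj N)).app (p ⁻¹ᵁ V))) :
    Function.Bijective fun t : Γ((Scheme.Modules.pullback p).obj N, p ⁻¹ᵁ V) =>
      ((Scheme.Modules.pullback p₀).obj ((Scheme.Modules.pullback j).obj N)).presheaf.map
        (homOfLE (preimage_preimage_eq_of_comp_eq p j i p₀ w V).ge).op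
      ((((Scheme.Modules.pullbackPushforwardAdjunction i).unit.app
          ((Scheme.Modules.pullback p).obj N)) ≫
        (Scheme.Modules.pushforward i).map
          ((Scheme.Modules.pullbackComp i p).hom.app N ≫ (Scheme.Modules.pullbackCongr w).hom.app N ≫
            (Scheme.Modules.pullbackComp p₀ j).inv.app N)).app (p ⁻¹ᵁ V) t) := by
  have hB : Function.Bijective ((((Scheme.Modules.pullbackPushforwardAdjunction i).unit.app
          ((Scheme.Modules.pullback p).obj N)) ≫
        (Scheme.Modules.pushforward i).map
          ((Scheme.Modules.pullbackComp i p).hom.app N ≫ (Scheme.Modules.pullbackCongr w).hom.app N ≫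
            (Scheme.Modules.pullbackComp p₀ j).inv.app N)).app (p ⁻¹ᵁ V)) := by
    change Function.Bijective fun t =>
      (((Scheme.Modules.pullbackComp i p).hom.app N ≫ (Scheme.Modules.pullbackCongr w).hom.app N ≫
        (Scheme.Modules.pullbackComp p₀ j).inv.app N).app (i ⁻¹ᵁ (p ⁻¹ᵁ V)))
      ((((Scheme.Modules.pullbackPushforwardAdjunction i).unit.app
          ((Scheme.Modules.pullback p).obj N)).app (p ⁻¹ᵁ V)) t)
    exact (app_bijective_of_isIso
      ((Scheme.Modules.pullbackComp i p).hom.app N ≫ (Scheme.Modules.pullbackCongr w).hom.app N ≫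
        (Scheme.Modules.pullbackComp p₀ j).inv.app N) (i ⁻¹ᵁ (p ⁻¹ᵁ V))).comp h
  exact (presheaf_map_bijective_of_eq' _ (preimage_preimage_eq_of_comp_eq p j i p₀ w V) _).comp hB

/-- Bijectivity in the CLOSED case: `i` a closed immersion and `p^*N` affine-localizing and killed
by the kernel ideal of `i` (`Modules/PullbackClosedImmersionUnitIso`). [cite: GortzWedhorn2023, proof of Thm. 24.94 and Prop. 24.95 (pp. 566–567), auxiliary step] -/
theorem unit_app_bijective_of_isClosedImmersion [IsClosedImmersion i] (F : P.Modules)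
    (hF : IsAffineLocalizing F) (hK : IsKilledBy i.ker F) (U : P.Opens) :
    Function.Bijective (((Scheme.Modules.pullbackPushforwardAdjunction i).unit.app F).app U) :=
  haveI := isIso_unit_of_isKilledBy_ker i F hF hK
  app_bijective_of_isIso _ U

end Square

end GrothendieckExistenceProper

end Literature.AlgebraicGeometry.FormalGeometry.WittGrothendieckExistence

end
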